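import Summits.QuantumFields.BalabanUV.T4Continuum.Support.NE3EnergyChartLeavesWeighted
import Summits.QuantumFields.BalabanUV.T4Continuum.Support.NE3EnergyWeightedShapes

/-!
# T⁴ programme, node NE3 — sub-row S5-Y0-chart, file 3∕3: THE WEIGHTED END AND THE RE-TYPED ROOT T-E_w FROM THE CHART'S
# LEAVES, IN THE OWNER'S SOCKETS (`NE3EnergyWeightedShapes`: `energyNormW`, `CurlPairedResidual`, `WeightedTangentCoercive`,
# `NE3EnergyRateW`)

NE3 (node U1b) formalisation swarm, leaf seat `b2b-balaban-t4-ne3-formalise-leaf-03` (gen 5), sub-row **S5-Y0-chart** of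
`HOME/t4/formal/NE3/LEAVES.md`, third file, written ON THE ROW OWNER'S REQUEST (journal l.12722, t4-ne3-p1-g19: «your
`normW`-instance should conclude `energyNormW L k (cavg L U_B) (Γ 0) (periodBox (N·L^k)) ≤ (1+θ₀)·(2r/c)` and, over pairs with
`r = C′·residualScale`, `NE3EnergyRateW … ((1+θ₀)·(2/c)·C′) dom`»).  Files 1∕2 (`NE3EnergyChartLeaves`: `ChartLeaves … Nrm …`,
`norm_le_of_chartLeaves` in ANY norm) and 2∕2 (`NE3EnergyChartLeavesWeighted`: `cont_weighted` with the displayed constant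
`Λ_w(α, a, s) = (1 + 24√d·(e^α − 1)·s)² + 48·d·a·s²`) are norm-generic ∕ inline-weighted; THIS FILE instantiates them at the
owner's η-weighted norm `NE3EnergyWeightedShapes.energyNormW L k W Z F = √(curlSq W Z F + (L^k)⁻²·dirSq Z F)` (p217682) and
reads the two repair sockets (RES♯) `CurlPairedResidual` and (ML_w) `WeightedTangentCoercive` ([folklore]; 0 `def`, 0 sorry):

* §1 `energyNormW_eq_sqrt_div` — `energyNormW L k W Z F = √(curlSq W Z F + dirSq Z F∕(L^k)²)` (the inline weight of file 2 at
  `s = L^k`); `hasDerivAt_unique_dAction` — row Y9's «`∀ D, HasDerivAt (σ ↦ A(W e^{σX})) D 0 → …`» binder IS a statement about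
  `dAction W X` (uniqueness of derivatives), so (RES♯) at `X ∈ T` feeds it.
* §2 **`energyNormW_le_of_chartLeaves`** — THE WEIGHTED END AT ONE PAIR IN THE SOCKETS: chart leaves in the norm
  `energyNormW L k W · F` (`coer` = (ML_w) read ALONG THE PATH in the norm at `W`, see §3), sup-radius `α` of the path,
  plaquette radius `a`, `Λ_w(α, a, L^k) ≤ Λ`, (RES♯) `CurlPairedResidual L k W T r F`, `U_A` a minimiser, `W` unitary,
  `0 < c`, `0 ≤ θ₀`, `0 ≤ r`, budget `2Λθ + Λθ² + κ ≤ c∕2` ⟹ **`energyNormW L k W (Γ 0) F ≤ (1 + θ₀)·(2r∕c)`**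
  (`W = cavg L U_B`, `F = periodBox (N·L^k)`).
* §3 **`coer_of_weightedTangentCoercive_vary`** — the bridge from the owner's (ML_w) AT THE MOVING CONFIGURATION to the
  field `coer` (coercivity along the path measured in the FIXED norm at `W`): if `WeightedTangentCoercive L k (W·e^{X}) T c F`
  and `‖X(b)‖ ≤ α`, then for periodic `Y ∈ T`, `(c∕(2 + 24√d·(e^α−1)·L^k)²)·energyNormW L k W Y F² ≤ hess (W·e^X) Y Y (F ×ˢ univ)`
  (curl transport `NE3EnergyHessContTwoTerm.sqrt_curlSq_vary_le` from `W·e^X` back to `W = (W·e^X)·e^{−X}`); so (ML_w) holding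
  UNIFORMLY over the configurations of the path (all in the regular class) gives `coer` with a constant degraded by the
  displayed k-free factor once `α·L^k` is bounded.  Which of the two readings v1.9 adopts is the owner's call; both are served.
* §4 **`ne3EnergyRateW_of_chartLeaves`** — THE RE-TYPED ROOT FROM THE CHART'S LEAVES: if at every level `k ≥ 1`, datum
  `V ∈ dom` and minimiser pair `(U_A, U_B)` with `U_B` `Regular b g (k+1)` the background `cavg L U_B` is unitary and there are
  chart leaves in `energyNormW L k` with UNIFORM `(c, θ, κ, θ₀)`, level data `(α_k, a_k)` with `Λ_w(α_k, a_k, L^k) ≤ Λ`, and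
  (RES♯) with `r = C′·residualScale d L N b g k`, then **`NE3EnergyRateW d 𝒞 L N b g ((1+θ₀)·(2∕c)·C′) dom`** — the owner's
  T-E_w BY NAME, CONDITIONAL on exactly: the chart leaves (L1 REP + L2 chart + `coer`), (RES♯), and the k-uniformity of
  `Λ_w` (i.e. `α_k·L^k`, `a_k·L^{2k}` bounded).

HONEST FRAMING.  Finite-T⁴ bookkeeping (rung (B)+1); kernel composition; (ML_w) and (RES♯) are the owner's hypothesis
SHAPES, NOT proved here or anywhere in the tree; the chart leaves are hypotheses; T-E_w NOT proved; NE3 NOT proved; spine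
PROVED 0∕9; no conditional of the cell used or hidden; NOT infinite volume, NOT a mass gap, NOT Clay, NOT summit progress.
ABSOLUTE RULE kept: no printed sentence is a hypothesis.  PLACEMENT: `Summits/QuantumFields/BalabanUV/`; imports this
lineage's file 2∕2 and the owner's `Support.NE3EnergyWeightedShapes` BY NAME; restates nothing, moves nothing.  HONEST
DEPENDENCY: continuum YM on T⁴ ⇐ BetaPertH ∧ nine spine estimates (0/9 proved); BetaPertH ⇐ (D1) ∧ (D4) ∧ CAP+tail;
G-an2-4 gates asym, D1 and NE2/3/4.
-/

set_option autoImplicit false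

open scoped BigOperators Matrix.Norms.L2Operator
open NormedSpace Finset

namespace Summit.QuantumFields.BalabanUV.T4Continuum.NE3EnergyChartLeavesSockets

open Set
open Literature.MathematicalPhysics.QuantumFieldTheory.Balaban1983to89
open B7Prop1Explicit B7Prop2Explicit MatrixLog UnitaryModel
open T4AveragingDeficitWall hiding Site Plane Plaq Bond
open T4AveragingDeficitWallBoundary (IsPeriodicCfg periodBox)
open AveragingDeficitPeriodicCounting (IsPeriodicDir)
open AveragingDeficitChartCalculus (cavg)
open AveragingDeficitPlaqDeriv (vary_isUnitaryCfg)
open MinimalActionLevels (perWin)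
open MinimalActionSandwich (IsMinimiser admissible)
open MinimalActionRate (Regular)
open NE3EnergyShapes (energyNorm residualScale residualScale_nonneg IsUnitarySite IsPeriodicSite)
open NE3HessForm (dAction hess vary_add hasDerivAt_fineAction_vary_at)
open NE3EnergyHessCont (HsPer perExt isPeriodicDir_perExt perExt_eq_of_periodic)
open NE3EnergyHessContTwoTerm (sqrt_curlSq_vary_le)
open NE3EnergyChartLeaves (ChartLeaves isPeriodicDir_vel norm_le_of_chartLeaves)
open NE3EnergyChartLeavesWeighted (cont_weighted)
open NE3EnergyWeightedShapes (energyNormW energyNormW_nonneg NE3EnergyRateW WeightedTangentCoercive CurlPairedResidual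
  sqrt_curlSq_le_energyNormW weighted_sqrt_dirSq_le_energyNormW)

noncomputable section

variable {d : ℕ} {n : Type*} [Fintype n] [DecidableEq n]

/-! ## §1 Bookkeeping between the inline weight of file 2 and the owner's `energyNormW` -/

/-- The owner's η-weighted norm IS file 2's inline weight at `s = L^k`:
`energyNormW L k W Z F = √(curlSq W Z F + dirSq Z F ∕ (L^k)²)`. [folklore] -/
theorem energyNormW_eq_sqrt_div (L k : ℕ) (W : Site d → Fin d → (Matrix n n ℂ)ˣ) (Z : Site d → Fin d → Matrix n n ℂ)
    (F : Finset (Site d)) :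
    energyNormW L k W Z F = Real.sqrt (curlSq W Z F + dirSq Z F / ((L : ℝ) ^ k) ^ 2) := by
  unfold NE3EnergyWeightedShapes.energyNormW
  congr 1
  rw [inv_pow, div_eq_mul_inv, mul_comm (dirSq Z F)]

/-- The same as an equality of norm functionals. [folklore] -/
theorem energyNormW_fun_eq (L k : ℕ) (W : Site d → Fin d → (Matrix n n ℂ)ˣ) (F : Finset (Site d)) :
    (fun Z : Site d → Fin d → Matrix n n ℂ => energyNormW L k W Z F)
      = fun Z => Real.sqrt (curlSq W Z F + dirSq Z F / ((L : ℝ) ^ k) ^ 2) :=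
  funext fun Z => energyNormW_eq_sqrt_div L k W Z F

/-- Row Y9's residual binder is a statement about `dAction`: any derivative `D` at `0` of `σ ↦ A_{Wn}(W e^{σX})` equals
`dAction W X Wn` (uniqueness of derivatives, `NE3HessForm.hasDerivAt_fineAction_vary_at`). [folklore] -/
theorem hasDerivAt_unique_dAction (W : Site d → Fin d → (Matrix n n ℂ)ˣ) (X : Site d → Fin d → Matrix n n ℂ)
    (Wn : Finset (T4AveragingDeficitWall.Plaq d)) {D : ℝ}
    (hD : HasDerivAt (fun σ : ℝ => fineAction (vary W X σ) Wn) D 0) : D = dAction W X Wn := by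
  have h0 := hasDerivAt_fineAction_vary_at W X Wn 0
  rw [vary_zero] at h0
  exact hD.unique h0

/-- (RES♯) at a direction `X ∈ T` feeds row Y9's residual binder in the weighted norm. [folklore] -/
theorem res_of_curlPairedResidual {L k : ℕ} {W : Site d → Fin d → (Matrix n n ℂ)ˣ}
    {T : Set (Site d → Fin d → Matrix n n ℂ)} {r : ℝ} {P : ℕ} (hres : CurlPairedResidual L k W T r (periodBox P))
    {X : Site d → Fin d → Matrix n n ℂ} (hX : X ∈ T) :
    ∀ D : ℝ, HasDerivAt (fun σ : ℝ => fineAction (vary W X σ) (perWin d P)) D 0 → |D| ≤ r * energyNormW L k W X (periodBox P) := by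
  intro D hD
  rw [hasDerivAt_unique_dAction W X (perWin d P) hD]
  exact hres X hX

/-! ## §2 The weighted END at one pair, in the sockets -/

/-- **THE WEIGHTED END AT ONE PAIR, IN THE OWNER'S SOCKETS.**  Level `k`, `1 ≤ L`, `1 ≤ N`, background `W = cavg L U_B`
unitary, period box `F = periodBox (N·L^k)`; chart leaves `h` in the norm `energyNormW L k W · F` with constants
`(c, θ, κ, θ₀)` and plaquette radius `a ≥ 0`; sup-radius `α ≥ 0` of the path; the two-term continuity constant dominated by
`Λ`: `(1 + 24√d·(e^α − 1)·L^k)² + 48·d·a·(L^k)² ≤ Λ`; (RES♯) `CurlPairedResidual L k W T r F` with `r ≥ 0`; `U_A` a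
minimiser of run `k`; `0 < c`, `0 ≤ θ₀` and the budget `2Λθ + Λθ² + κ ≤ c∕2`.  THEN
**`energyNormW L k W (Γ 0) F ≤ (1 + θ₀)·(2r∕c)`** — file 1's `norm_le_of_chartLeaves` at `energyNormW ∘ perExt`, file 2's
`cont_weighted`, §1. [folklore] -/
theorem energyNormW_le_of_chartLeaves [Nonempty n] {𝒞 : ℕ → Set (Site d → Fin d → (Matrix n n ℂ)ˣ)} {L N k : ℕ}
    (hL : 1 ≤ L) (hN : 1 ≤ N) {V UA UB : Site d → Fin d → (Matrix n n ℂ)ˣ} (hW : IsUnitaryCfg (cavg L UB))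
    {u : Site d → (Matrix n n ℂ)ˣ} {Γ Ψ Ψ' : ℝ → Site d → Fin d → Matrix n n ℂ}
    {T : Set (Site d → Fin d → Matrix n n ℂ)} {c Λ θ κ θ₀ a r α : ℝ} (hα : 0 ≤ α) (ha0 : 0 ≤ a)
    (h : ChartLeaves 𝒞 L N k V UA UB u Γ Ψ Ψ' T
      (fun Y => energyNormW L k (cavg L UB) Y (periodBox (N * L ^ k))) c θ κ θ₀ a)
    (hΓα : ∀ t (x : Site d) (μ : Fin d), ‖Γ t x μ‖ ≤ α)
    (hΛw : (1 + 24 * Real.sqrt d * (Real.exp α - 1) * (L : ℝ) ^ k) ^ 2 + 48 * d * a * ((L : ℝ) ^ k) ^ 2 ≤ Λ)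
    (hres : CurlPairedResidual L k (cavg L UB) T r (periodBox (N * L ^ k)))
    (hA : IsMinimiser d 𝒞 L N k V UA) (hθ₀ : 0 ≤ θ₀) (hr : 0 ≤ r) (hc : 0 < c)
    (hbudget : 2 * Λ * θ + Λ * θ ^ 2 + κ ≤ c / 2) :
    energyNormW L k (cavg L UB) (Γ 0) (periodBox (N * L ^ k)) ≤ (1 + θ₀) * (2 * r / c) := by
  have hL0 : (0 : ℝ) < L := by exact_mod_cast hL
  have hs : (0 : ℝ) < (L : ℝ) ^ k := pow_pos hL0 k
  have hP : 1 ≤ N * L ^ k := Nat.mul_pos (by omega) (Nat.pow_pos (by omega))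
  -- the weighted norm read through the periodic extension agrees with `energyNormW` on periodic directions
  have hN : ∀ Y : Site d → Fin d → Matrix n n ℂ, IsPeriodicDir Y ((N * L ^ k : ℕ) : ℤ) →
      Real.sqrt (curlSq (cavg L UB) (perExt (N * L ^ k) Y) (periodBox (N * L ^ k))
        + dirSq (perExt (N * L ^ k) Y) (periodBox (N * L ^ k)) / ((L : ℝ) ^ k) ^ 2)
      = (fun Y => energyNormW L k (cavg L UB) Y (periodBox (N * L ^ k))) Y := by
    intro Y hY
    show _ = energyNormW L k (cavg L UB) Y (periodBox (N * L ^ k))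
    rw [perExt_eq_of_periodic _ hY, energyNormW_eq_sqrt_div]
  have h' := NE3EnergyChartLeavesWeighted.ChartLeaves.of_eqOn_periodic
    (Nrm' := fun Y => Real.sqrt (curlSq (cavg L UB) (perExt (N * L ^ k) Y) (periodBox (N * L ^ k))
      + dirSq (perExt (N * L ^ k) Y) (periodBox (N * L ^ k)) / ((L : ℝ) ^ k) ^ 2)) hN h
  have h1 : IsPeriodicDir (Ψ 1) ((N * L ^ k : ℕ) : ℤ) := isPeriodicDir_vel h.per (h.vel 1 ⟨zero_le_one, le_rfl⟩)
  have hΛw0 : (0 : ℝ) ≤ (1 + 24 * Real.sqrt d * (Real.exp α - 1) * (L : ℝ) ^ k) ^ 2 + 48 * d * a * ((L : ℝ) ^ k) ^ 2 := by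
    positivity
  have hΛ : 0 ≤ Λ := hΛw0.trans hΛw
  -- the continuity clause with the dominating constant `Λ`
  have hcont : ∀ t ∈ Icc (0:ℝ) 1, ∀ Y Z : Site d → Fin d → Matrix n n ℂ,
      |HsPer (vary (cavg L UB) (Γ t) 1) (perWin d (N * L ^ k)) (N * L ^ k) Y Z|
        ≤ Λ * (fun Y => Real.sqrt (curlSq (cavg L UB) (perExt (N * L ^ k) Y) (periodBox (N * L ^ k))
              + dirSq (perExt (N * L ^ k) Y) (periodBox (N * L ^ k)) / ((L : ℝ) ^ k) ^ 2)) Y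
            * (fun Y => Real.sqrt (curlSq (cavg L UB) (perExt (N * L ^ k) Y) (periodBox (N * L ^ k))
              + dirSq (perExt (N * L ^ k) Y) (periodBox (N * L ^ k)) / ((L : ℝ) ^ k) ^ 2)) Z := by
    intro t ht Y Z
    have hc0 := cont_weighted hW h.skew hα hΓα hP ha0 h.small hs t ht Y Z
    have hY0 := Real.sqrt_nonneg (curlSq (cavg L UB) (perExt (N * L ^ k) Y) (periodBox (N * L ^ k))
      + dirSq (perExt (N * L ^ k) Y) (periodBox (N * L ^ k)) / ((L : ℝ) ^ k) ^ 2)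
    have hZ0 := Real.sqrt_nonneg (curlSq (cavg L UB) (perExt (N * L ^ k) Z) (periodBox (N * L ^ k))
      + dirSq (perExt (N * L ^ k) Z) (periodBox (N * L ^ k)) / ((L : ℝ) ^ k) ^ 2)
    refine hc0.trans ?_
    have := mul_le_mul_of_nonneg_right (mul_le_mul_of_nonneg_right hΛw hY0) hZ0
    simpa only [mul_assoc] using this
  -- the residual binder in the extended norm
  have hres' : ∀ D : ℝ, HasDerivAt (fun σ : ℝ => fineAction (vary (cavg L UB) (Ψ 1) σ) (perWin d (N * L ^ k))) D 0 →
      |D| ≤ r * Real.sqrt (curlSq (cavg L UB) (perExt (N * L ^ k) (Ψ 1)) (periodBox (N * L ^ k))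
        + dirSq (perExt (N * L ^ k) (Ψ 1)) (periodBox (N * L ^ k)) / ((L : ℝ) ^ k) ^ 2) := by
    intro D hD
    rw [hN _ h1]
    exact res_of_curlPairedResidual hres h.tangent D hD
  have hend := norm_le_of_chartLeaves hL hW (fun Y => Real.sqrt_nonneg _) h' hA hΛ hθ₀ hr hc hbudget hcont hres'
  rw [hN _ (h.per 0)] at hend
  exact hend

/-! ## §3 The bridge from (ML_w) at the moving configuration to the field `coer` -/

/-- Undoing a unit perturbation: `(W·e^{X})·e^{−X} = W`. [folklore] -/
theorem vary_vary_neg_one (W : Site d → Fin d → (Matrix n n ℂ)ˣ) (X : Site d → Fin d → Matrix n n ℂ) :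
    vary (vary W X 1) X (-1) = W := by
  rw [← vary_add, add_neg_cancel, vary_zero]

/-- **CURL TRANSPORT FOR THE WEIGHTED NORM**: for unitary `W`, skew `X` with `‖X(b)‖ ≤ α` (`α ≥ 0`), `1 ≤ L`, `1 ≤ M` and an
`M`-periodic direction `Y`:
`energyNormW L k W Y (periodBox M) ≤ (2 + 24√d·(e^α − 1)·L^k) · energyNormW L k (W·e^X) Y (periodBox M)`
(`√(A² + B²) ≤ A + B`, `sqrt_curlSq_vary_le` from `W·e^X` back to `W`, `√dirSq ≤ L^k·energyNormW`). [folklore] -/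
theorem energyNormW_le_vary [Nonempty n] {L : ℕ} (hL : 1 ≤ L) (k : ℕ) {W : Site d → Fin d → (Matrix n n ℂ)ˣ}
    (hW : IsUnitaryCfg W) {X : Site d → Fin d → Matrix n n ℂ} (hX : IsSkewDir X) {α : ℝ} (hα : 0 ≤ α)
    (hXα : ∀ x κ, ‖X x κ‖ ≤ α) {M : ℕ} (hM : 1 ≤ M) {Y : Site d → Fin d → Matrix n n ℂ} (hY : IsPeriodicDir Y (M : ℤ)) :
    energyNormW L k W Y (periodBox M)
      ≤ (2 + 24 * Real.sqrt d * (Real.exp α - 1) * (L : ℝ) ^ k) * energyNormW L k (vary W X 1) Y (periodBox M) := by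
  have hL0 : (0 : ℝ) < L := by exact_mod_cast hL
  have hs : (0 : ℝ) < (L : ℝ) ^ k := pow_pos hL0 k
  set Wt := vary W X 1 with hWt
  have hWt_u : IsUnitaryCfg Wt := vary_isUnitaryCfg hW hX 1
  -- transport from `Wt` back to `W = Wt·e^{−X}`
  have htr := sqrt_curlSq_vary_le hWt_u hX hα hXα (-1) hM hY
  rw [hWt, vary_vary_neg_one, ← hWt] at htr
  have habs : |(-1 : ℝ)| * α = α := by simp
  rw [habs] at htr
  set δ := Real.exp α - 1 with hδ
  have hδ0 : 0 ≤ δ := by rw [hδ]; linarith [Real.add_one_le_exp α]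
  set Nt := energyNormW L k Wt Y (periodBox M) with hNt
  have hNt0 : 0 ≤ Nt := energyNormW_nonneg _ _ _ _ _
  have hC0 : 0 ≤ curlSq W Y (periodBox M) := by unfold curlSq; positivity
  have hD0 : 0 ≤ dirSq Y (periodBox M) := by unfold dirSq; positivity
  -- the two pieces of the weighted norm at `W` against `Nt`
  have hcurl_t : Real.sqrt (curlSq Wt Y (periodBox M)) ≤ Nt := sqrt_curlSq_le_energyNormW L k Wt Y _
  have hdir_t : ((L : ℝ) ^ k)⁻¹ * Real.sqrt (dirSq Y (periodBox M)) ≤ Nt := weighted_sqrt_dirSq_le_energyNormW hL k Wt Y _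
  have hdir_t' : Real.sqrt (dirSq Y (periodBox M)) ≤ (L : ℝ) ^ k * Nt := by
    have := mul_le_mul_of_nonneg_left hdir_t hs.le
    rwa [← mul_assoc, mul_inv_cancel₀ hs.ne', one_mul] at this
  have hA : Real.sqrt (curlSq W Y (periodBox M)) ≤ (1 + 24 * Real.sqrt d * δ * (L : ℝ) ^ k) * Nt := by
    have h24 : 0 ≤ 24 * Real.sqrt d * δ := by positivity
    calc Real.sqrt (curlSq W Y (periodBox M))
        ≤ Real.sqrt (curlSq Wt Y (periodBox M)) + 24 * Real.sqrt d * δ * Real.sqrt (dirSq Y (periodBox M)) := htr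
      _ ≤ Nt + 24 * Real.sqrt d * δ * ((L : ℝ) ^ k * Nt) := add_le_add hcurl_t (mul_le_mul_of_nonneg_left hdir_t' h24)
      _ = (1 + 24 * Real.sqrt d * δ * (L : ℝ) ^ k) * Nt := by ring
  -- `√(curlSq + (L^k)⁻²·dirSq) ≤ √curlSq + (L^k)⁻¹·√dirSq`
  have hsplit : energyNormW L k W Y (periodBox M)
      ≤ Real.sqrt (curlSq W Y (periodBox M)) + ((L : ℝ) ^ k)⁻¹ * Real.sqrt (dirSq Y (periodBox M)) := by
    have hx := Real.sqrt_nonneg (curlSq W Y (periodBox M))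
    have hy : 0 ≤ ((L : ℝ) ^ k)⁻¹ * Real.sqrt (dirSq Y (periodBox M)) :=
      mul_nonneg (inv_nonneg.mpr hs.le) (Real.sqrt_nonneg _)
    have e1 : Real.sqrt (curlSq W Y (periodBox M)) ^ 2 = curlSq W Y (periodBox M) := Real.sq_sqrt hC0
    have e2 : (((L : ℝ) ^ k)⁻¹ * Real.sqrt (dirSq Y (periodBox M))) ^ 2
        = (((L : ℝ) ^ k)⁻¹) ^ 2 * dirSq Y (periodBox M) := by
      rw [mul_pow, Real.sq_sqrt hD0]
    have hrad : curlSq W Y (periodBox M) + (((L : ℝ) ^ k)⁻¹) ^ 2 * dirSq Y (periodBox M)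
        = Real.sqrt (curlSq W Y (periodBox M)) ^ 2 + (((L : ℝ) ^ k)⁻¹ * Real.sqrt (dirSq Y (periodBox M))) ^ 2 := by
      rw [e1, e2]
    have hle2 : Real.sqrt (curlSq W Y (periodBox M)) ^ 2 + (((L : ℝ) ^ k)⁻¹ * Real.sqrt (dirSq Y (periodBox M))) ^ 2
        ≤ (Real.sqrt (curlSq W Y (periodBox M)) + ((L : ℝ) ^ k)⁻¹ * Real.sqrt (dirSq Y (periodBox M))) ^ 2 := by
      nlinarith [mul_nonneg hx hy]
    show Real.sqrt (curlSq W Y (periodBox M) + (((L : ℝ) ^ k)⁻¹) ^ 2 * dirSq Y (periodBox M)) ≤ _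
    rw [hrad]
    exact (Real.sqrt_le_sqrt hle2).trans (le_of_eq (Real.sqrt_sq (add_nonneg hx hy)))
  calc energyNormW L k W Y (periodBox M)
      ≤ Real.sqrt (curlSq W Y (periodBox M)) + ((L : ℝ) ^ k)⁻¹ * Real.sqrt (dirSq Y (periodBox M)) := hsplit
    _ ≤ (1 + 24 * Real.sqrt d * δ * (L : ℝ) ^ k) * Nt + Nt := by
        exact add_le_add hA hdir_t
    _ = (2 + 24 * Real.sqrt d * (Real.exp α - 1) * (L : ℝ) ^ k) * Nt := by rw [hδ]; ring

/-- **(ML_w) AT THE MOVING CONFIGURATION ⇒ `coer` IN THE FIXED NORM.**  If the owner's weighted tangent coercivity holds at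
the perturbed configuration `W·e^X` on `T` with constant `c ≥ 0` (`WeightedTangentCoercive L k (vary W X 1) T c (periodBox M)`),
`‖X(b)‖ ≤ α`, then for every `M`-periodic `Y ∈ T`:
`(c ∕ (2 + 24√d·(e^α − 1)·L^k)²) · energyNormW L k W Y (periodBox M)² ≤ hess (W·e^X) Y Y (periodBox M ×ˢ univ)` —
the field `ChartLeaves.coer` at time `t` (with `X := Γ t`) in the norm at the background `W`, constant degraded by the displayed
factor (k-free once `α·L^k` is bounded). [folklore] -/
theorem coer_of_weightedTangentCoercive_vary [Nonempty n] {L : ℕ} (hL : 1 ≤ L) (k : ℕ)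
    {W : Site d → Fin d → (Matrix n n ℂ)ˣ} (hW : IsUnitaryCfg W) {X : Site d → Fin d → Matrix n n ℂ} (hX : IsSkewDir X)
    {α : ℝ} (hα : 0 ≤ α) (hXα : ∀ x κ, ‖X x κ‖ ≤ α) {M : ℕ} (hM : 1 ≤ M)
    {T : Set (Site d → Fin d → Matrix n n ℂ)} {c : ℝ} (hc : 0 ≤ c)
    (hML : WeightedTangentCoercive L k (vary W X 1) T c (periodBox M))
    {Y : Site d → Fin d → Matrix n n ℂ} (hYT : Y ∈ T) (hY : IsPeriodicDir Y (M : ℤ)) :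
    c / (2 + 24 * Real.sqrt d * (Real.exp α - 1) * (L : ℝ) ^ k) ^ 2 * energyNormW L k W Y (periodBox M) ^ 2
      ≤ hess (vary W X 1) Y Y (periodBox M ×ˢ Finset.univ) := by
  set K := 2 + 24 * Real.sqrt d * (Real.exp α - 1) * (L : ℝ) ^ k with hK
  have hδ0 : 0 ≤ Real.exp α - 1 := by linarith [Real.add_one_le_exp α]
  have hK0 : 0 < K := by rw [hK]; positivity
  have hle := energyNormW_le_vary hL k hW hX hα hXα hM hY
  rw [← hK] at hle
  have hN0 : 0 ≤ energyNormW L k W Y (periodBox M) := energyNormW_nonneg _ _ _ _ _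
  have hsq : energyNormW L k W Y (periodBox M) ^ 2 ≤ K ^ 2 * energyNormW L k (vary W X 1) Y (periodBox M) ^ 2 := by
    rw [← mul_pow]; exact pow_le_pow_left₀ hN0 hle 2
  have hML' := hML Y hYT
  calc c / K ^ 2 * energyNormW L k W Y (periodBox M) ^ 2
      ≤ c / K ^ 2 * (K ^ 2 * energyNormW L k (vary W X 1) Y (periodBox M) ^ 2) :=
        mul_le_mul_of_nonneg_left hsq (div_nonneg hc (sq_nonneg _))
    _ = c * energyNormW L k (vary W X 1) Y (periodBox M) ^ 2 := by field_simp
    _ ≤ hess (vary W X 1) Y Y (periodBox M ×ˢ Finset.univ) := hML'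

/-! ## §4 The re-typed root T-E_w from the chart's leaves -/

/-- **THE RE-TYPED ROOT T-E_w FROM THE CHART'S LEAVES** (`NE3EnergyWeightedShapes.NE3EnergyRateW` BY NAME).  For any class
family `𝒞`, `1 ≤ L`, `1 ≤ N`, UNIFORM constants `(c, Λ, θ, κ, θ₀, C′)` with `0 < c`, `0 ≤ θ₀`, `0 ≤ C′` and the budget
`2Λθ + Λθ² + κ ≤ c∕2`: IF at every level `k ≥ 1`, every datum `V ∈ dom` and every pair of minimisers `(U_A, U_B)` with `U_B`
`Regular b g (k+1)` the background `cavg L U_B` is unitary and there are chart leaves in the norm `energyNormW L k (cavg L U_B) ·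
(periodBox (N·L^k))` with those constants and level data `(α, a)` (`0 ≤ α`, `0 ≤ a`, sup-radius `α` of the path,
`Λ_w(α, a, L^k) ≤ Λ`) together with (RES♯) of size `C′·residualScale d L N b g k` on the tangent space `T`, THEN
`NE3EnergyRateW d 𝒞 L N b g ((1 + θ₀)·(2∕c)·C′) dom`.  CONDITIONAL on exactly the chart leaves, (RES♯) and the k-uniformity
of `Λ_w`; nothing of it is proved for Bałaban's minimisers. [folklore] -/
theorem ne3EnergyRateW_of_chartLeaves [Nonempty n] {𝒞 : ℕ → Set (Site d → Fin d → (Matrix n n ℂ)ˣ)} {L N : ℕ}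
    (hL : 1 ≤ L) (hN : 1 ≤ N) {b g : ℝ} {dom : Set (Site d → Fin d → (Matrix n n ℂ)ˣ)} {c Λ θ κ θ₀ C' : ℝ}
    (hθ₀ : 0 ≤ θ₀) (hc : 0 < c) (hC' : 0 ≤ C') (hbudget : 2 * Λ * θ + Λ * θ ^ 2 + κ ≤ c / 2)
    (hchart : ∀ k : ℕ, 1 ≤ k → ∀ V ∈ dom, ∀ UA UB : Site d → Fin d → (Matrix n n ℂ)ˣ,
      IsMinimiser d 𝒞 L N k V UA → IsMinimiser d 𝒞 L N (k + 1) V UB → Regular d L N b g (k + 1) UB →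
        IsUnitaryCfg (cavg L UB) ∧
        ∃ (u : Site d → (Matrix n n ℂ)ˣ) (Γ Ψ Ψ' : ℝ → Site d → Fin d → Matrix n n ℂ)
          (T : Set (Site d → Fin d → Matrix n n ℂ)) (α a : ℝ), 0 ≤ α ∧ 0 ≤ a ∧
          ChartLeaves 𝒞 L N k V UA UB u Γ Ψ Ψ' T
            (fun Y => energyNormW L k (cavg L UB) Y (periodBox (N * L ^ k))) c θ κ θ₀ a ∧
          (∀ t (x : Site d) (μ : Fin d), ‖Γ t x μ‖ ≤ α) ∧
          (1 + 24 * Real.sqrt d * (Real.exp α - 1) * (L : ℝ) ^ k) ^ 2 + 48 * d * a * ((L : ℝ) ^ k) ^ 2 ≤ Λ ∧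
          CurlPairedResidual L k (cavg L UB) T (C' * residualScale d L N b g k) (periodBox (N * L ^ k))) :
    NE3EnergyRateW d 𝒞 L N b g ((1 + θ₀) * (2 / c) * C') dom := by
  intro k hk V hV UA UB hA hB hreg
  obtain ⟨hW, u, Γ, Ψ, Ψ', T, α, a, hα, ha0, h, hΓα, hΛw, hres⟩ := hchart k hk V hV UA UB hA hB hreg
  have hr : 0 ≤ C' * residualScale d L N b g k := mul_nonneg hC' (residualScale_nonneg d L N b g k)
  have hend := energyNormW_le_of_chartLeaves hL hN hW hα ha0 h hΓα hΛw hres hA hθ₀ hr hc hbudget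
  refine ⟨u, Γ 0, h.gauge.1, h.gauge.2, h.skew 0, h.per 0, ?_, ?_⟩
  · exact h.rep
  · have hcv : cavg L UB = rescale L (bavg L UB) := rfl
    rw [hcv] at hend
    refine hend.trans (le_of_eq ?_)
    ring

end

end Summit.QuantumFields.BalabanUV.T4Continuum.NE3EnergyChartLeavesSockets
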